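import Literature.Geometry.Lorentzian.HarmonicallyFlatDecay
import HarnessLib

/-!
# Asymptotically flat data of order `α > 0` with one end are complete

`AsymptoticallyFlatCompleteness.lean` proves (`isComplete_of_isSoleEnd_holds`, Gordon's
criterion) that data whose metric lies in a *strong* decay class
`IsStronglyAsymptoticallyFlatWith D M β γ nh nk` on an end `e` which is the only end
(`e.IsSoleEnd`) are geodesically complete. Here the hypothesis is relaxed to Bartnik's weighted
class `e.IsAsymptoticallyFlat D α` of any order `α > 0` (`|∂^m(h - δ)| = O(r^{-α-m})`,
`m ≤ 2`; `|∂^m k| = O(r^{-α-1-m})`, `m ≤ 1`) — the hypothesis of the positive mass theorems of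
the tree (`positive_mass_theorem_spacetime`, `positive_mass_rigidity_spacetime`, with `α = 1`):

* `AFEnd.IsAsymptoticallyFlat.isStronglyAsymptoticallyFlatWith_zero` — `O(r^{-α-m})` is
  `o(r^{-β-m})` for `β < α` (`isLittleO_norm_rpow_rpow_cobounded`), so order-`α` flatness is
  strong flatness with mass parameter `M = 0`, rates `β < α`, `γ < α + 1`, and `(nh, nk) = (2, 1)`;
* `AFEnd.isComplete_of_isAsymptoticallyFlat_of_isSoleEnd` — hence **asymptotically flat data of
  order `α > 0` on a sole end are complete** (Schoen–Yau 1979, §1: completeness is part of the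
  set-up "`N ∖ K` consists of a finite number of ends"; Beig–Chruściel 1996, Thm. 4.1:
  `Σ = Σ_int ∪ Σ_ext`, `Σ_int` compact).

Theorems only; no definitions, no named facts.

## References

* R. Schoen, S.-T. Yau, Comm. Math. Phys. 65 (1979) 45–76, §1. [SchoenYauPMT1979]
* R. Beig, P. T. Chruściel, J. Math. Phys. 37 (1996) 1939–1961, Thm. 4.1 (hypotheses).
  [BeigChrusciel1996]
* W. B. Gordon, Proc. Amer. Math. Soc. 37 (1973) 221–225. [Gordon1973]
-/

noncomputable section

open Bundle Set Filter Metric Asymptotics Bornology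
open scoped Manifold ContDiff Topology

namespace Literature.Geometry.Lorentzian

namespace AFEnd

variable {X : Type} [TopologicalSpace X] [ChartedSpace E3 X] [IsManifold (𝓡 3) ∞ X]
  {e : AFEnd X} {D : InitialDataSet (𝓡 3) X}

/-- **Order-`α` asymptotic flatness is strong asymptotic flatness with `M = 0` and any slower
rates**: if `h - δ = O₂(r^{-α})`, `k = O₁(r^{-α-1})` then `h - (1 + 0/r) δ = o₂(r^{-β})` and
`k = o₁(r^{-γ})` for all `β < α`, `γ < α + 1`. [cite: Bartnik1986, Def. 2.1] -/
theorem IsAsymptoticallyFlat.isStronglyAsymptoticallyFlatWith_zero {α β γ : ℝ}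
    (h : e.IsAsymptoticallyFlat D α) (hβ : β < α) (hγ : γ < α + 1) :
    e.IsStronglyAsymptoticallyFlatWith D 0 β γ 2 1 := by
  have hfun : (fun y : E3 ↦ hCoeff e D y - (1 + 2 * (0 : ℝ) / ‖y‖) •
      (innerSL ℝ : E3 →L[ℝ] E3 →L[ℝ] ℝ)) =
        fun y ↦ hCoeff e D y - (innerSL ℝ : E3 →L[ℝ] E3 →L[ℝ] ℝ) := by
    funext y
    rw [mul_zero, zero_div, add_zero, one_smul]
  refine ⟨fun m hm ↦ ?_, fun m hm ↦ ?_⟩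
  · rw [hfun]
    refine (h.1 m hm).trans_isLittleO ?_
    exact isLittleO_norm_rpow_rpow_cobounded (by linarith)
  · refine (h.2 m hm).trans_isLittleO ?_
    exact isLittleO_norm_rpow_rpow_cobounded (by linarith)

/-- **Asymptotically flat data of order `α > 0` whose end is the only end are complete**
(`isComplete_of_isSoleEnd_holds` with `isStronglyAsymptoticallyFlatWith_zero`, `β = α/2`,
`γ = α`). In particular the data of the rigid positive energy theorem
(`positive_mass_rigidity_spacetime`: order `1`, `e.IsSoleEnd`) are complete, as in its printed
hypotheses (Beig–Chruściel 1996, Thm. 4.1: `Σ_int` compact). [cite: SchoenYauPMT1979, §1 (p. 47)] -/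
theorem isComplete_of_isAsymptoticallyFlat_of_isSoleEnd [T2Space X] [SecondCountableTopology X]
    [ConnectedSpace X] [D.metric.HasLeviCivita] {α : ℝ} (hα : 0 < α)
    (haf : e.IsAsymptoticallyFlat D α) (hsole : e.IsSoleEnd) : D.IsComplete :=
  isComplete_of_isSoleEnd_holds X D e 0 (α / 2) α 2 1 (by linarith)
    (haf.isStronglyAsymptoticallyFlatWith_zero (β := α / 2) (γ := α) (by linarith) (by linarith))
    hsole

end AFEnd

end Literature.Geometry.Lorentzian

end
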